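import Summits.ValiantsHypothesis.ValiantsHypothesis.Theorems.DivisionGapZeroOneTransferFormulaToIMM
import Summits.ValiantsHypothesis.ValiantsHypothesis.Theorems.DivisionGapZeroOneTransferIMMToSpan
import Literature.Computability.AlgebraicComplexity.QuasiPolynomialFormulasProofs
import Literature.Computability.AlgebraicComplexity.ValiantClassesProofs

/-!
# Route DivisionGap, crux `ZeroOneTransfer` (stmt-ValiantsHypothesis-5066), line `arborescence-span` —
# the SIGNED ARBORESCENCE SPAN (S1): every `VP_ℂ` family over `ℝ≥0` is a signed quotient of
# positive projections of the spanning-tree polynomial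

`stub_signedSpan` (registered stub of the lead's skeleton `Cruxes/ZeroOneTransfer/Lines/arborescence-span.lean`):
for every family `f_n ∈ ℝ≥0[σ_n]` whose complexification is in `VP_ℂ` there is `c` such that for all
`n` some `N ≤ 2^((log₂ n + c)^c)` and positive Valiant projections `A, B, C` of Jerrum–Snir's
`stPoly ℝ≥0 N` (arborescence polynomials of arc-labelled digraphs on `N` non-root nodes, zero labels
allowed) satisfy `A ≠ 0` and `f_n · A + C = B`.  No 0/1 hypothesis is needed: this is the
theorem-grade half of the line; the other half (`stub_signElimination`, Kirchhoff sign elimination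
for 0/1 polynomials) is the crux-strength bet.

## Proof (no circuit surgery)

* a common exponent `E(n) = (log₂ n + c₀)^{c₀}` dominates degree, variable count and complexity of
  `g_n = f_n ⊗ ℂ` (`exists_common_qp_exponent`), so `g_n` has a FORMULA of size `≤ 2^{18 E²}` over
  `ℂ` (`formulaComplexity_le_two_pow`: Valiant–Skyum–Berkowitz–Rackoff + Brent, BCS 1997
  Thm (21.35)/(21.36), proved in the tree);
* `stub_formulaToIMM` (landed, `DivisionGapZeroOneTransferFormulaToIMM.lean`): the formula is an
  entry of a product of `d` LABELLED `w × w` matrices over `ℂ` (entries variables or constants),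
  `w, d ≤ 4 (E_ℂ + 1)^4`;
* REALIFICATION as a block identity (`SignedSpan.realify_prod`): `ℂ ↪ M₂(ℝ)`,
  `c ↦ [[re c, −im c], [im c, re c]]` label by label; the product of the doubled real matrices is
  `[[P, −Q], [Q, P]]` with `P + iQ` the complex product, and `f_n ⊗ ℝ = P_{st}` (`eq_of_toC_eq`);
* TWO-RAIL as a block identity (`SignedSpan.twoRail_prod`, Valiant 1979 Lemma 3): a real label is
  `pos − neg` over `ℝ≥0`; the product of the doubled matrices `[[U, V], [V, U]]` is `[[E, O], [O, E]]`
  with `E − O` the real product, so `f_n = E_{st} − O_{st}` over `ℝ`;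
* `stub_immToSpan` (landed, `DivisionGapZeroOneTransferIMMToSpan*.lean`, the PADDING LEMMA):
  `E_{st} · A = B⁺`, `O_{st} · A = B⁻` with ONE nonzero `A ∈ Proj(ST_N)`, `N ≤ 4 (4·4w + d + 1)^8`;
  hence `f_n · A + B⁻ = B⁺` (injectivity of `ℝ≥0[x] ↪ ℝ[x]`), and
  `N ≤ 2^{700 E²} ≤ 2^{(log₂ n + 2c₀ + 10)^{2c₀+10}}` (`span_size_le`, `sevenHundred_mul_sq_le_pow`).

Labels are written `Sum.elim X C l` for `l : τ ⊕ R` (as in `Negative/Exchange.lean`); no new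
definitions.  References: Valiant 1979 (two-rail; universality of iterated matrix products for
formulas); Bürgisser–Clausen–Shokrollahi 1997 Thm (21.33)–(21.36); Jerrum–Snir 1982 §4.5 (`ST`).
Helpers live in the sub-namespace `SignedSpan` (sibling stub files use `ProjClosure`,
`FormulaToIMM`, `IMMToSpan`).
-/

noncomputable section

-- Sub = Summit single-conjunct layout: the duplicated namespace component is mandated by the tree.
set_option linter.dupNamespace false

namespace Summit.ValiantsHypothesis.ValiantsHypothesis.Theorems.DivisionGapZeroOneTransfer

open Literature.Computability.AlgebraicComplexity Literature.Barriers.ValiantsHypothesis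
open MvPolynomial Finset
open scoped NNReal

namespace SignedSpan

/-! ### Labels -/

/-- A label polynomial `Sum.elim X C l` is a label in the sense of the stubs. [folklore] -/
theorem label_isLabel {R : Type*} [CommSemiring R] {τ : Type*} (l : τ ⊕ R) :
    (∃ x, (Sum.elim X C l : MvPolynomial τ R) = X x) ∨ ∃ a, (Sum.elim X C l : MvPolynomial τ R) = C a := by
  rcases l with x | a
  · exact Or.inl ⟨x, rfl⟩
  · exact Or.inr ⟨a, rfl⟩

/-- Extracting label data from a labelled family of matrices. [folklore] -/
theorem exists_labels {R : Type*} [CommSemiring R] {τ ι : Type*} {d : ℕ}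
    {M : Fin d → Matrix ι ι (MvPolynomial τ R)}
    (hM : ∀ l i j, (∃ x, M l i j = X x) ∨ (∃ a, M l i j = C a)) :
    ∃ lab : Fin d → ι → ι → τ ⊕ R, ∀ l i j, M l i j = Sum.elim X C (lab l i j) := by
  classical
  refine ⟨fun l i j => if h : ∃ x, M l i j = X x then Sum.inl h.choose
    else Sum.inr (((hM l i j).resolve_left h).choose), fun l i j => ?_⟩
  by_cases h : ∃ x, M l i j = X x
  · simp only [dif_pos h, Sum.elim_inl]; exact h.choose_spec
  · simp only [dif_neg h, Sum.elim_inr]; exact ((hM l i j).resolve_left h).choose_spec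

/-! ### Realification `ℂ ↪ M₂(ℝ)` of labelled matrix products -/

section Realify

variable {τ : Type} {ι : Type} [Fintype ι] [DecidableEq ι]

omit [Fintype ι] [DecidableEq ι] in
/-- A complex label is `re + I · im` of two real labels (variables are real). [folklore] -/
theorem label_complex (l : τ ⊕ ℂ) :
    (Sum.elim X C l : MvPolynomial τ ℂ) =
      MvPolynomial.map Complex.ofRealHom
          (Sum.elim X C (Sum.elim Sum.inl (fun c => Sum.inr c.re) l : τ ⊕ ℝ) : MvPolynomial τ ℝ) +
        C Complex.I * MvPolynomial.map Complex.ofRealHom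
          (Sum.elim X C (Sum.elim (fun _ => Sum.inr 0) (fun c => Sum.inr c.im) l : τ ⊕ ℝ) :
            MvPolynomial τ ℝ) := by
  rcases l with x | c
  · simp
  · simp only [Sum.elim_inr, map_C, Complex.ofRealHom_eq_coe, ← C_mul, ← C_add]
    congr 1
    apply Complex.ext <;> simp

/-- **Realification of a product of matrices**: the product of the block matrices
`[[R_l, -S_l], [S_l, R_l]]` is `[[P, -Q], [Q, P]]` where `P + I Q` is the product of the complex
matrices `R_l + I S_l` (the ring embedding `ℂ ↪ M₂(ℝ)`, blockwise). [folklore] -/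
theorem realify_prod : ∀ (d : ℕ) (R S : Fin d → Matrix ι ι (MvPolynomial τ ℝ)),
    ∃ P Q : Matrix ι ι (MvPolynomial τ ℝ),
      (List.ofFn fun l => Matrix.fromBlocks (R l) (-S l) (S l) (R l)).prod =
        Matrix.fromBlocks P (-Q) Q P ∧
      (List.ofFn fun l => (R l).map (MvPolynomial.map Complex.ofRealHom) +
          (C Complex.I : MvPolynomial τ ℂ) • (S l).map (MvPolynomial.map Complex.ofRealHom)).prod =
        P.map (MvPolynomial.map Complex.ofRealHom) +
          (C Complex.I : MvPolynomial τ ℂ) • Q.map (MvPolynomial.map Complex.ofRealHom)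
  | 0, R, S => ⟨1, 0, by simp [Matrix.fromBlocks_one], by simp⟩
  | d + 1, R, S => by
    obtain ⟨P, Q, h1, h2⟩ := realify_prod d (fun l => R l.succ) (fun l => S l.succ)
    refine ⟨R 0 * P - S 0 * Q, R 0 * Q + S 0 * P, ?_, ?_⟩
    · rw [List.ofFn_succ, List.prod_cons, h1, Matrix.fromBlocks_multiply]
      congr 1
      · rw [Matrix.neg_mul, sub_eq_add_neg]
      · rw [Matrix.mul_neg, Matrix.neg_mul, neg_add]
      · rw [add_comm]
      · rw [Matrix.mul_neg, add_comm, sub_eq_add_neg]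
    · rw [List.ofFn_succ, List.prod_cons, h2]
      have hI : (C Complex.I : MvPolynomial τ ℂ) * C Complex.I = -1 := by
        rw [← C_mul, Complex.I_mul_I, C_neg, C_1]
      rw [add_mul, mul_add, mul_add, Matrix.map_sub _ (map_sub _), Matrix.map_add _ (map_add _),
        Matrix.map_mul, Matrix.map_mul, Matrix.map_mul, Matrix.map_mul, smul_add]
      simp only [Matrix.smul_mul, Matrix.mul_smul, smul_smul, hI, neg_smul, one_smul]
      abel

end Realify

/-! ### Valiant's two-rail split as a block identity -/

section TwoRail

variable {τ : Type} {κ : Type} [Fintype κ] [DecidableEq κ]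

omit [Fintype κ] [DecidableEq κ] in
/-- A real label is the difference of its two rails over `ℝ≥0` (variables are positive). [folklore] -/
theorem label_real (l : τ ⊕ ℝ) :
    (Sum.elim X C l : MvPolynomial τ ℝ) =
      MvPolynomial.map NNReal.toRealHom
          (Sum.elim X C (Sum.elim Sum.inl (fun a => Sum.inr (Real.toNNReal a)) l : τ ⊕ ℝ≥0) :
            MvPolynomial τ ℝ≥0) -
        MvPolynomial.map NNReal.toRealHom
          (Sum.elim X C (Sum.elim (fun _ => Sum.inr 0) (fun a => Sum.inr (Real.toNNReal (-a))) l :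
              τ ⊕ ℝ≥0) : MvPolynomial τ ℝ≥0) := by
  rcases l with x | a
  · simp
  · simp only [Sum.elim_inr, map_C, ← C_sub]
    congr 1
    simp only [NNReal.coe_toRealHom, Real.coe_toNNReal']
    exact (max_zero_sub_max_neg_zero_eq_self a).symm

/-- **Two-rail product** (Valiant 1979, Lemma 3, in block form): the product of the block matrices
`[[U_l, V_l], [V_l, U_l]]` over `ℝ≥0` is `[[E, O], [O, E]]` with `E − O = Π_l (U_l − V_l)` over `ℝ`.
[cite: Valiant1979, Lemma 3] -/
theorem twoRail_prod : ∀ (d : ℕ) (U V : Fin d → Matrix κ κ (MvPolynomial τ ℝ≥0)),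
    ∃ E O : Matrix κ κ (MvPolynomial τ ℝ≥0),
      (List.ofFn fun l => Matrix.fromBlocks (U l) (V l) (V l) (U l)).prod =
        Matrix.fromBlocks E O O E ∧
      (List.ofFn fun l => (U l).map (MvPolynomial.map NNReal.toRealHom) -
          (V l).map (MvPolynomial.map NNReal.toRealHom)).prod =
        E.map (MvPolynomial.map NNReal.toRealHom) - O.map (MvPolynomial.map NNReal.toRealHom)
  | 0, U, V => ⟨1, 0, by simp [Matrix.fromBlocks_one], by simp⟩
  | d + 1, U, V => by
    obtain ⟨E, O, h1, h2⟩ := twoRail_prod d (fun l => U l.succ) (fun l => V l.succ)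
    refine ⟨U 0 * E + V 0 * O, U 0 * O + V 0 * E, ?_, ?_⟩
    · rw [List.ofFn_succ, List.prod_cons, h1, Matrix.fromBlocks_multiply]
      congr 1 <;> abel
    · rw [List.ofFn_succ, List.prod_cons, h2]
      rw [sub_mul, mul_sub, mul_sub, Matrix.map_add _ (map_add _), Matrix.map_add _ (map_add _),
        Matrix.map_mul, Matrix.map_mul, Matrix.map_mul, Matrix.map_mul]
      abel

end TwoRail

/-! ### Real polynomials inside complex ones -/

/-- If `a ⊗ ℂ = b ⊗ ℂ + I · (c ⊗ ℂ)` for real polynomials `a b c` then `a = b`. [folklore] -/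
theorem eq_of_toC_eq {τ : Type} {a b c : MvPolynomial τ ℝ}
    (h : MvPolynomial.map Complex.ofRealHom a =
      MvPolynomial.map Complex.ofRealHom b + C Complex.I * MvPolynomial.map Complex.ofRealHom c) :
    a = b := by
  ext m
  have hm := congrArg (MvPolynomial.coeff m) h
  simp only [coeff_map, coeff_add, coeff_C_mul, Complex.ofRealHom_eq_coe] at hm
  have := congrArg Complex.re hm
  simpa using this

/-! ### Quasi-polynomial bookkeeping -/

/-- `4 (5 · 4 (F+1)^4 + 1)^8 ≤ 2^(700 E²)` whenever `F ≤ 2^(18 E²)` and `1 ≤ E`. [folklore] -/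
theorem span_size_le {F E : ℕ} (hE : 1 ≤ E) (hF : F ≤ 2 ^ (18 * E ^ 2)) :
    4 * (5 * (4 * (F + 1) ^ 4) + 1) ^ 8 ≤ 2 ^ (700 * E ^ 2) := by
  have h2a : 1 ≤ 2 ^ (18 * E ^ 2) := Nat.one_le_two_pow
  have h1 : F + 1 ≤ 2 ^ (18 * E ^ 2 + 1) := by rw [pow_succ]; omega
  have h3 : 5 * (4 * (F + 1) ^ 4) + 1 ≤ 2 ^ (4 * (18 * E ^ 2) + 9) := by
    have h2 : 4 * (F + 1) ^ 4 ≤ 2 ^ (4 * (18 * E ^ 2) + 6) := by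
      calc 4 * (F + 1) ^ 4 ≤ 4 * (2 ^ (18 * E ^ 2 + 1)) ^ 4 :=
            Nat.mul_le_mul_left 4 (Nat.pow_le_pow_left h1 4)
        _ = 2 ^ (4 * (18 * E ^ 2) + 6) := by
            rw [← pow_mul, show 4 * (18 * E ^ 2) + 6 = 2 + (18 * E ^ 2 + 1) * 4 by ring, pow_add]
            norm_num
    have : 1 ≤ 2 ^ (4 * (18 * E ^ 2) + 6) := Nat.one_le_two_pow
    have h8 : (2 : ℕ) ^ (4 * (18 * E ^ 2) + 9) = 8 * 2 ^ (4 * (18 * E ^ 2) + 6) := by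
      rw [show 4 * (18 * E ^ 2) + 9 = (4 * (18 * E ^ 2) + 6) + 3 by ring, pow_add]; ring
    rw [h8]; omega
  calc 4 * (5 * (4 * (F + 1) ^ 4) + 1) ^ 8 ≤ 4 * (2 ^ (4 * (18 * E ^ 2) + 9)) ^ 8 :=
        Nat.mul_le_mul_left 4 (Nat.pow_le_pow_left h3 8)
    _ = 2 ^ (2 + (4 * (18 * E ^ 2) + 9) * 8) := by rw [← pow_mul, pow_add]; norm_num
    _ ≤ 2 ^ (700 * E ^ 2) := by
        apply Nat.pow_le_pow_right two_pos
        have : 1 ≤ E ^ 2 := Nat.one_le_pow _ _ hE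
        omega

/-- The exponent bookkeeping: `700 ((ℓ + c₀)^{c₀})² ≤ (ℓ + c)^c` for `c = 2c₀ + 10`. [folklore] -/
theorem sevenHundred_mul_sq_le_pow (c₀ ℓ : ℕ) :
    700 * ((ℓ + c₀) ^ c₀) ^ 2 ≤ (ℓ + (2 * c₀ + 10)) ^ (2 * c₀ + 10) := by
  have hx : 10 ≤ ℓ + (2 * c₀ + 10) := by omega
  have h1 : ((ℓ + c₀) ^ c₀) ^ 2 ≤ (ℓ + (2 * c₀ + 10)) ^ (2 * c₀) := by
    calc ((ℓ + c₀) ^ c₀) ^ 2 = (ℓ + c₀) ^ (2 * c₀) := by rw [← pow_mul, Nat.mul_comm]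
      _ ≤ (ℓ + (2 * c₀ + 10)) ^ (2 * c₀) := Nat.pow_le_pow_left (by omega) _
  have h2 : 700 ≤ (ℓ + (2 * c₀ + 10)) ^ 10 :=
    calc (700 : ℕ) ≤ 10 ^ 10 := by norm_num
      _ ≤ (ℓ + (2 * c₀ + 10)) ^ 10 := Nat.pow_le_pow_left hx 10
  calc 700 * ((ℓ + c₀) ^ c₀) ^ 2
      ≤ (ℓ + (2 * c₀ + 10)) ^ 10 * (ℓ + (2 * c₀ + 10)) ^ (2 * c₀) := Nat.mul_le_mul h2 h1
    _ = (ℓ + (2 * c₀ + 10)) ^ (2 * c₀ + 10) := by rw [← pow_add, Nat.add_comm 10 (2 * c₀)]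

end SignedSpan

open SignedSpan

/-! ### The stub: the signed arborescence span (S1) -/

/-- **The signed span (S1), registered stub `stub_signedSpan` of the line `arborescence-span`.**
For every family `f_n ∈ ℝ≥0[σ_n]` whose complexification is a `VP_ℂ` family there is `c` with: for
all `n` some `N ≤ 2^((log₂ n + c)^c)` and positive projections `A, B, C` of `stPoly ℝ≥0 N` satisfy
`A ≠ 0 ∧ f_n · A + C = B`.  Proof: common exponent (`exists_common_qp_exponent`), qp formula over
`ℂ` (`formulaComplexity_le_two_pow`), labelled IMM (`stub_formulaToIMM`), realification and
two-rail as block identities (`realify_prod`, `twoRail_prod`), padding lemma (`stub_immToSpan`),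
arithmetic (`span_size_le`, `sevenHundred_mul_sq_le_pow`), `c = 2c₀ + 10`.
[cite: Valiant1979, Lemma 3] -/
theorem stub_signedSpan :
    ∀ (σ : ℕ → Type) [∀ n, Fintype (σ n)] (f : ∀ n, MvPolynomial (σ n) NNReal),
      Literature.Computability.AlgebraicComplexity.IsVPFamily
        (fun n => MvPolynomial.map (Complex.ofRealHom.comp NNReal.toRealHom) (f n)) →
      ∃ c : ℕ, ∀ n, ∃ N ≤ 2 ^ ((Nat.log 2 n + c) ^ c),
        ∃ A B C : MvPolynomial (σ n) NNReal,
          Literature.Computability.AlgebraicComplexity.IsProjection A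
              (Literature.Barriers.ValiantsHypothesis.stPoly NNReal N) ∧
          Literature.Computability.AlgebraicComplexity.IsProjection B
              (Literature.Barriers.ValiantsHypothesis.stPoly NNReal N) ∧
          Literature.Computability.AlgebraicComplexity.IsProjection C
              (Literature.Barriers.ValiantsHypothesis.stPoly NNReal N) ∧
          A ≠ 0 ∧ f n * A + C = B := by
  intro σ _ f hVP
  classical
  obtain ⟨c₀, hc₀⟩ := exists_common_qp_exponent hVP.1.2 hVP.1.1 hVP.2.isQPBounded
  refine ⟨2 * c₀ + 10, fun n => ?_⟩
  obtain ⟨hE, hd, hn, hL⟩ := hc₀ n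
  -- the three embeddings
  set φ : MvPolynomial (σ n) ℝ →+* MvPolynomial (σ n) ℂ := MvPolynomial.map Complex.ofRealHom
    with hφ
  set ψ : MvPolynomial (σ n) ℝ≥0 →+* MvPolynomial (σ n) ℝ := MvPolynomial.map NNReal.toRealHom
    with hψ
  set g : MvPolynomial (σ n) ℂ :=
    MvPolynomial.map (Complex.ofRealHom.comp NNReal.toRealHom) (f n) with hgdef
  have hform : formulaComplexity g ≤ 2 ^ (18 * ((Nat.log 2 n + c₀) ^ c₀) ^ 2) :=
    formulaComplexity_le_two_pow le_rfl hd hn hL hE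
  -- labelled IMM over ℂ
  obtain ⟨w, d, M, s, t, hw, hdd, hlab, hp⟩ := stub_formulaToIMM ℂ (σ n) g
  obtain ⟨lab, hlabel⟩ := exists_labels hlab
  -- realification: real and imaginary label parts
  set reL : σ n ⊕ ℂ → σ n ⊕ ℝ := Sum.elim Sum.inl (fun c => Sum.inr c.re) with hreL
  set imL : σ n ⊕ ℂ → σ n ⊕ ℝ := Sum.elim (fun _ => Sum.inr 0) (fun c => Sum.inr c.im) with himL
  set niL : σ n ⊕ ℂ → σ n ⊕ ℝ := Sum.elim (fun _ => Sum.inr 0) (fun c => Sum.inr (-c.im)) with hniL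
  have hni : ∀ l : σ n ⊕ ℂ, (Sum.elim X C (niL l) : MvPolynomial (σ n) ℝ) = -Sum.elim X C (imL l) := by
    intro l; rcases l with x | c <;> simp [hniL, himL]
  set R : Fin d → Matrix (Fin w) (Fin w) (MvPolynomial (σ n) ℝ) :=
    fun l => Matrix.of fun i j => Sum.elim X C (reL (lab l i j)) with hRdef
  set S : Fin d → Matrix (Fin w) (Fin w) (MvPolynomial (σ n) ℝ) :=
    fun l => Matrix.of fun i j => Sum.elim X C (imL (lab l i j)) with hSdef
  have hM : ∀ l, M l = (R l).map φ + (C Complex.I : MvPolynomial (σ n) ℂ) • (S l).map φ := by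
    intro l
    refine Matrix.ext fun i j => ?_
    rw [hlabel, label_complex]
    simp [hRdef, hSdef, hreL, himL, hφ]
  obtain ⟨P, Q, hPQ1, hPQ2⟩ := realify_prod d R S
  have hg : g = φ (P s t) + C Complex.I * φ (Q s t) := by
    rw [hp, show List.ofFn M =
        List.ofFn (fun l => (R l).map φ + (C Complex.I : MvPolynomial (σ n) ℂ) • (S l).map φ) from
      congrArg _ (funext hM), hφ, hPQ2]
    simp [Matrix.add_apply, Matrix.smul_apply, Matrix.map_apply]
  have hfg : φ (ψ (f n)) = g := by
    rw [hgdef, hφ, hψ]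
    exact MvPolynomial.map_map _ _ _
  have hfP : ψ (f n) = P s t := eq_of_toC_eq (hfg.trans hg)
  -- the realified labels on `Fin w ⊕ Fin w`, and their two rails
  set rlab : Fin d → (Fin w ⊕ Fin w) → (Fin w ⊕ Fin w) → σ n ⊕ ℝ := fun l a b =>
    Sum.elim (fun i => Sum.elim (fun j => reL (lab l i j)) (fun j => niL (lab l i j)) b)
      (fun i => Sum.elim (fun j => imL (lab l i j)) (fun j => reL (lab l i j)) b) a with hrlab
  set poL : σ n ⊕ ℝ → σ n ⊕ ℝ≥0 := Sum.elim Sum.inl (fun a => Sum.inr (Real.toNNReal a)) with hpoL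
  set neL : σ n ⊕ ℝ → σ n ⊕ ℝ≥0 :=
    Sum.elim (fun _ => Sum.inr 0) (fun a => Sum.inr (Real.toNNReal (-a))) with hneL
  set U : Fin d → Matrix (Fin w ⊕ Fin w) (Fin w ⊕ Fin w) (MvPolynomial (σ n) ℝ≥0) :=
    fun l => Matrix.of fun a b => Sum.elim X C (poL (rlab l a b)) with hUdef
  set V : Fin d → Matrix (Fin w ⊕ Fin w) (Fin w ⊕ Fin w) (MvPolynomial (σ n) ℝ≥0) :=
    fun l => Matrix.of fun a b => Sum.elim X C (neL (rlab l a b)) with hVdef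
  have hUV : ∀ l, (U l).map ψ - (V l).map ψ = Matrix.fromBlocks (R l) (-S l) (S l) (R l) := by
    intro l
    refine Matrix.ext fun a b => ?_
    have hab : ((U l).map ψ - (V l).map ψ) a b = Sum.elim X C (rlab l a b) := by
      simp only [hUdef, hVdef, Matrix.sub_apply, Matrix.map_apply, Matrix.of_apply, hψ, hpoL, hneL]
      exact (label_real _).symm
    rw [hab]
    rcases a with i | i <;> rcases b with j | j <;>
      simp [hrlab, hRdef, hSdef, Matrix.fromBlocks, hni]
  obtain ⟨E', O', hEO1, hEO2⟩ := twoRail_prod d U V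
  have hP' : P s t = ψ (E' (Sum.inl s) (Sum.inl t)) - ψ (O' (Sum.inl s) (Sum.inl t)) := by
    have h := hEO2
    rw [← hψ, show (List.ofFn fun l => (U l).map ψ - (V l).map ψ) =
        List.ofFn (fun l => Matrix.fromBlocks (R l) (-S l) (S l) (R l)) from
      congrArg _ (funext hUV), hPQ1] at h
    have := congrFun (congrFun h (Sum.inl s)) (Sum.inl t)
    simpa [Matrix.fromBlocks_apply₁₁, Matrix.sub_apply, Matrix.map_apply] using this
  -- the final labelled matrices over `ℝ≥0`
  set D : Fin d → Matrix ((Fin w ⊕ Fin w) ⊕ (Fin w ⊕ Fin w)) ((Fin w ⊕ Fin w) ⊕ (Fin w ⊕ Fin w))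
      (MvPolynomial (σ n) ℝ≥0) := fun l => Matrix.of fun a b =>
    Sum.elim (fun i => Sum.elim (fun j => U l i j) (fun j => V l i j) b)
      (fun i => Sum.elim (fun j => V l i j) (fun j => U l i j) b) a with hDdef
  have hDblocks : ∀ l, D l = Matrix.fromBlocks (U l) (V l) (V l) (U l) := fun l => by
    refine Matrix.ext fun a b => ?_
    rcases a with i | i <;> rcases b with j | j <;> simp [hDdef, Matrix.fromBlocks]
  have hDlab : ∀ l a b, (∃ x, D l a b = X x) ∨ (∃ c, D l a b = C c) := fun l a b => by
    rcases a with i | i <;> rcases b with j | j <;>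
      simp only [hDdef, hUdef, hVdef, Matrix.of_apply, Sum.elim_inl, Sum.elim_inr] <;>
      exact label_isLabel _
  obtain ⟨N, hN, A, hA, hA0, hB⟩ :=
    stub_immToSpan (σ n) ((Fin w ⊕ Fin w) ⊕ (Fin w ⊕ Fin w)) d D hDlab
  obtain ⟨Bp, hBp, hBpeq⟩ := hB (Sum.inl (Sum.inl s)) (Sum.inl (Sum.inl t))
  obtain ⟨Bm, hBm, hBmeq⟩ := hB (Sum.inl (Sum.inl s)) (Sum.inr (Sum.inl t))
  have hprodD : (List.ofFn D).prod = Matrix.fromBlocks E' O' O' E' := by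
    rw [show List.ofFn D = List.ofFn (fun l => Matrix.fromBlocks (U l) (V l) (V l) (U l)) from
      congrArg _ (funext hDblocks), hEO1]
  rw [hprodD, Matrix.fromBlocks_apply₁₁] at hBpeq
  rw [hprodD, Matrix.fromBlocks_apply₁₂] at hBmeq
  refine ⟨N, ?_, A, Bp, Bm, hA, hBp, hBm, hA0, ?_⟩
  · -- the size
    have hcard : Fintype.card ((Fin w ⊕ Fin w) ⊕ (Fin w ⊕ Fin w)) = 4 * w := by
      simp only [Fintype.card_sum, Fintype.card_fin]; ring
    rw [hcard] at hN
    have h1 : 4 * w + d + 1 ≤ 5 * (4 * (formulaComplexity g + 1) ^ 4) + 1 := by omega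
    calc N ≤ 4 * (4 * w + d + 1) ^ 8 := hN
      _ ≤ 4 * (5 * (4 * (formulaComplexity g + 1) ^ 4) + 1) ^ 8 :=
          Nat.mul_le_mul_left 4 (Nat.pow_le_pow_left h1 8)
      _ ≤ 2 ^ (700 * ((Nat.log 2 n + c₀) ^ c₀) ^ 2) := span_size_le hE hform
      _ ≤ 2 ^ ((Nat.log 2 n + (2 * c₀ + 10)) ^ (2 * c₀ + 10)) :=
          Nat.pow_le_pow_right two_pos (sevenHundred_mul_sq_le_pow c₀ (Nat.log 2 n))
  · -- the identity, by injectivity of `ℝ≥0[x] ↪ ℝ[x]`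
    apply MvPolynomial.map_injective NNReal.toRealHom NNReal.coe_injective
    change ψ (f n * A + Bm) = ψ Bp
    rw [map_add, map_mul, ← hBpeq, ← hBmeq, map_mul, map_mul, hfP, hP']
    ring

end Summit.ValiantsHypothesis.ValiantsHypothesis.Theorems.DivisionGapZeroOneTransfer

end
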